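import Summits.KontsevichZagierPeriods.Zeta5Search.RVLargeParamVZLayerLemmas
import HarnessLib

/-!
# RVLargeParamVZLayer — the ZERO-LAYER case of the constant-term floor (V⁺), PROVED (fam-rv gen 9, file 5)

HONEST FRAMING: systematic search; no irrationality claim unless certified.  This file mints NO conjecture: it PROVES
`ClusterValuation.val_ge_of_zLayer` — `v_p V(c) ≥ −4 ≥ t` under the decidable test `zLayerCase c p t` of
`RVLargeParamVZLayerLemmas.lean` — from tree theorems only.  `p`-adic valuations of rational numbers; nothing about irrationality.

PROOF.  Split `V = Σ_x V_x` over residue classes (`coeffV_eq_sum_classV`).  Non-deficient classes have `‖V_x‖ ≤ p⁴` termwise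
(`padicNorm_classV_le`).  A deficient class has a single pole `q` at level one or two, and `‖V_x − μ_q p⁻⁶‖ ≤ p⁴`: at level one
`H_q^{(σ)} ≡ p^{−σ}` (`CellA.padicNorm_harm_sub_level_le_one`); at level two `H_q^{(σ)} ≡ (1 + 2^{−σ}) p^{−σ}` and the extra
polar part `Σ_o c_{o,q} (2p)^{−(o+1)}` is `p`-integral because `q − 2p` is a zero (`padicNorm_polar_le_one`); the layers
`σ ≤ 4` have norm `≤ p⁴` (Theorem A′).  Finally `‖Σ_{q deficient} μ_q‖ ≤ p⁻²` by the top-layer accounting of the lemmas file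
(total `p·U(c)`, controlled poles `≤ p⁻²`, level-zero partners doubling the deficient total, `‖2‖_p = 1`).  Kernel instances
(`decide`) of the three formerly residual archetypes are at the end.
-/

noncomputable section

open Finset

namespace Summit.KontsevichZagierPeriods.Zeta5Search.ClusterValuation

open Summit.KontsevichZagierPeriods.Zeta5Search.WedgeDictionary (coeffV dOf)
open Summit.KontsevichZagierPeriods.Zeta5Search.CasoratianValuation (InPolytope)
open Summit.KontsevichZagierPeriods.Zeta5Search.PadicSeries

variable {p : ℕ} [hp : Fact p.Prime]

section ZLayer

open Summit.KontsevichZagierPeriods.Zeta5Search.WedgeDictionary (pfData coeffU)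
open Literature.NumberTheory.Transcendental.BallRivoal (harm)

/-- **ZERO-LAYER CASE (PROVED):** `v_p V(c) ≥ −4 ≥ t` under `zLayerCase c p t`. -/
theorem val_ge_of_zLayer (c : ℕ → ℤ) (hc : InPolytope c) (hp5 : 5 ≤ p) (hwin : (c 0 + 2 : ℤ) < (p : ℤ) ^ 2) {t : ℤ}
    (h : zLayerCase c p t = true) (hV : coeffV c ≠ 0) : t ≤ padicValRat p (coeffV c) := by
  simp only [zLayerCase, Bool.and_eq_true, Bool.or_eq_true, decide_eq_true_eq] at h
  obtain ⟨⟨⟨⟨⟨ht, hd⟩, hgood⟩, hD⟩, hC⟩, hM⟩ := h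
  have hp0 : (p : ℚ) ≠ 0 := Nat.cast_ne_zero.2 hp.out.ne_zero
  have hp1 : (1 : ℚ) ≤ p := one_le_p
  have hp4 : (1 : ℚ) ≤ (p : ℚ) ^ 4 := one_le_pow₀ hp1
  have hp2 : p ≠ 2 := by have := hp5; omega
  obtain ⟨-, -, -, hnp⟩ := thmA_data c hc hwin
  -- (1) split `V` over the residue classes, deficient / non-deficient
  have hsplitV : coeffV c = ∑ x ∈ (range p).filter (fun x => defClass c p x = true), classV c p x
      + ∑ x ∈ (range p).filter (fun x => ¬ defClass c p x = true), classV c p x := by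
    rw [coeffV_eq_sum_classV c hp.out.pos, Finset.sum_filter_add_sum_filter_not]
  -- (2) non-deficient classes: termwise (`classNuBound`)
  have hB : padicNorm p (∑ x ∈ (range p).filter (fun x => ¬ defClass c p x = true), classV c p x) ≤ (p : ℚ) ^ 4 := by
    refine padicNorm.sum_le' (fun x hx => ?_) (by positivity)
    obtain ⟨hxr, hxP⟩ := mem_filter.1 hx
    have hx' := mem_range.1 hxr
    by_cases h0 : classPoleCount c p x = 0
    · rw [classV_eq_zero_of_noPole c hc h0, padicNorm.zero]; positivity
    · have h1 : 1 ≤ classPoleCount c p x := by omega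
      have hnu : -4 ≤ classNu c p x := by
        by_contra hlt
        exact hxP ((defClass_iff c p x).2 ⟨h1, by omega⟩)
      calc padicNorm p (classV c p x) ≤ (p : ℚ) ^ (-classNu c p x) := padicNorm_classV_le c hc hp5 hwin hx' h1
        _ ≤ (p : ℚ) ^ (4 : ℤ) := zpow_le_zpow_right₀ hp1 (by omega)
        _ = (p : ℚ) ^ 4 := zpow_ofNat (p : ℚ) 4
  -- (3) deficient classes, position-wise: only the deficient poles contribute
  have hfib : ∀ x ∈ (range p).filter (fun x => defClass c p x = true),
      classV c p x = ∑ s ∈ (qSet c p).filter (fun s => s % p = x), posV c s := by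
    intro x hx
    obtain ⟨hxr, hPx⟩ := mem_filter.1 hx
    have hx' := mem_range.1 hxr
    have hxm : x % p = x := Nat.mod_eq_of_lt hx'
    have hcl : classV c p x = ∑ s ∈ classSet c p x, posV c s := rfl
    rw [hcl]
    symm
    apply Finset.sum_subset
    · intro s hs
      obtain ⟨hsQ, hsx⟩ := mem_filter.1 hs
      obtain ⟨hsR, -⟩ := mem_filter.1 hsQ
      exact mem_filter.2 ⟨hsR, by rw [hsx, hxm]⟩
    · intro s hs hns
      obtain ⟨hsR, hsx⟩ := mem_filter.1 hs
      have hs' : s ≤ (c 0).toNat := by have := mem_range.1 hsR; omega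
      have hsx' : s % p = x := by rw [hsx, hxm]
      have hnpole : ¬ netExp c s < 0 := by
        intro hneg
        apply hns
        refine mem_filter.2 ⟨mem_filter.2 ⟨hsR, (inQ_iff c p s).2 ⟨hneg, ?_⟩⟩, hsx'⟩
        rw [hsx']; exact hPx
      refine Finset.sum_eq_zero fun o ho => ?_
      rw [CellA.pfData_eq_zero_of_order_le c hc hs' (mem_range.1 ho) (by omega), zero_mul]
  have hfw : ∑ x ∈ range p, ∑ s ∈ (qSet c p).filter (fun s => s % p = x), posV c s = ∑ s ∈ qSet c p, posV c s :=
    Finset.sum_fiberwise_of_maps_to (fun s _ => mem_range.2 (Nat.mod_lt s hp.out.pos)) _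
  have hz : ∑ x ∈ (range p).filter (fun x => ¬ defClass c p x = true),
      ∑ s ∈ (qSet c p).filter (fun s => s % p = x), posV c s = 0 := by
    refine Finset.sum_eq_zero fun x hx => Finset.sum_eq_zero fun s hs => ?_
    exfalso
    obtain ⟨-, hxP⟩ := mem_filter.1 hx
    obtain ⟨hsQ, hsx⟩ := mem_filter.1 hs
    obtain ⟨-, hq⟩ := mem_filter.1 hsQ
    have hdef := ((inQ_iff c p s).1 hq).2
    rw [hsx] at hdef
    exact hxP hdef
  have hA : ∑ x ∈ (range p).filter (fun x => defClass c p x = true), classV c p x = ∑ s ∈ qSet c p, posV c s := by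
    rw [Finset.sum_congr rfl hfib, ← hfw, ← Finset.sum_filter_add_sum_filter_not (range p) (fun x => defClass c p x = true),
      hz, add_zero]
  -- (4) per deficient pole: `‖posV s − μ_s p⁻⁶‖ ≤ p⁴` (level one: `H ≡ p^{−σ}`; level two: `H ≡ (1 + 2^{−σ}) p^{−σ}` and the
  --     polar part at `k = 2p` is integral because `s − 2p` is a zero)
  have hFG : ∀ s ∈ qSet c p, padicNorm p (posV c s - muTop c p s / (p : ℚ) ^ 6) ≤ (p : ℚ) ^ 4 := by
    intro s hs
    obtain ⟨hs', hneg, hcnt, hps, hs3, hz2⟩ := qSet_specZ c hD hs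
    have hlow := padicNorm_posVsing_sub_le c hc hp5 hwin hs' hcnt
    have hone : padicNorm p (posV c s - posVsing c p s) ≤ 1 := by
      by_cases hlev : s < 2 * p
      · have hsub : posV c s - posVsing c p s
            = ∑ o ∈ range 6, pfData c o s * (harm (o + 1) s - 1 / (p : ℚ) ^ (o + 1)) := by
          unfold posV posVsing
          rw [← Finset.sum_sub_distrib]
          exact Finset.sum_congr rfl fun o _ => by ring
        rw [hsub]
        refine padicNorm.sum_le' (fun o ho => ?_) zero_le_one
        rw [padicNorm.mul]
        calc padicNorm p (pfData c o s) * padicNorm p (harm (o + 1) s - 1 / (p : ℚ) ^ (o + 1)) ≤ 1 * 1 :=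
              mul_le_mul (padicNorm_pfData_le_one c hc hp5 hwin hs' hcnt (mem_range.1 ho))
                (padicNorm_harm_sub_inv_pow_le_one hps hlev (o + 1)) (padicNorm.nonneg _) zero_le_one
          _ = 1 := one_mul 1
      · push Not at hlev
        have hdiv : s / p = 2 := Nat.div_eq_of_lt_le (by omega) (by omega)
        have h2 : ∀ i : ℕ, harm i 2 = 1 + 1 / (2 : ℚ) ^ i := by
          intro i
          simp only [harm, Finset.sum_range_succ, Finset.sum_range_zero, Nat.cast_zero, Nat.cast_one, zero_add]
          norm_num
        have hpol : padicNorm p (∑ o ∈ range 6, pfData c o s / (((2 * p : ℕ)) : ℚ) ^ (o + 1)) ≤ 1 :=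
          padicNorm_polar_le_one c hc hs' hnp hp2 (by omega) hlev (by push_cast; exact dvd_mul_left _ _)
            (by have := mult_eq_netExp c (s - 2 * p); have := hz2 hlev; omega) (mult_ge_six_of_single c hs' hneg hcnt)
        have hsub : posV c s - posVsing c p s
            = ∑ o ∈ range 6, pfData c o s * (harm (o + 1) s - harm (o + 1) (s / p) / (p : ℚ) ^ (o + 1))
              + ∑ o ∈ range 6, pfData c o s / (((2 * p : ℕ)) : ℚ) ^ (o + 1) := by
          unfold posV posVsing
          rw [← Finset.sum_add_distrib, ← Finset.sum_sub_distrib]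
          refine Finset.sum_congr rfl fun o _ => ?_
          rw [hdiv, h2]
          push_cast
          ring
        rw [hsub]
        refine (padicNorm.nonarchimedean (p := p)).trans (max_le ?_ hpol)
        refine padicNorm.sum_le' (fun o ho => ?_) zero_le_one
        rw [padicNorm.mul]
        calc padicNorm p (pfData c o s) * padicNorm p (harm (o + 1) s - harm (o + 1) (s / p) / (p : ℚ) ^ (o + 1))
              ≤ 1 * 1 :=
              mul_le_mul (padicNorm_pfData_le_one c hc hp5 hwin hs' hcnt (mem_range.1 ho))
                (CellA.padicNorm_harm_sub_level_le_one (p := p) (o + 1) s) (padicNorm.nonneg _) zero_le_one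
          _ = 1 := one_mul 1
    have e : posV c s - muTop c p s / (p : ℚ) ^ 6
        = (posV c s - posVsing c p s) + (posVsing c p s - muTop c p s / (p : ℚ) ^ 6) := by ring
    rw [e]
    exact (padicNorm.nonarchimedean (p := p)).trans (max_le (hone.trans hp4) hlow)
  -- (5) ACCOUNTING of the top layers: `‖Σ_{deficient} μ_q‖ ≤ p⁻²`
  have hμ : padicNorm p (∑ s ∈ qSet c p, muTop c p s) ≤ (p : ℚ) ^ (-2 : ℤ) := by
    have hU : padicNorm p ((p : ℚ) * coeffU c) ≤ (p : ℚ) ^ (-2 : ℤ) := by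
      have hU1 : padicNorm p (coeffU c) ≤ (p : ℚ) ^ (-1 : ℤ) := padicNorm_le_of_val fun hne => by
        have h := wrappedDivisibilityU_holds c p hc hp.out hp5 hwin hgood hne
        rwa [if_pos hd] at h
      rw [padicNorm.mul, padicNorm.padicNorm_p_of_prime]
      calc ((p : ℚ))⁻¹ * padicNorm p (coeffU c) ≤ ((p : ℚ))⁻¹ * (p : ℚ) ^ (-1 : ℤ) :=
            mul_le_mul_of_nonneg_left hU1 (by positivity)
        _ = (p : ℚ) ^ (-2 : ℤ) := by rw [← zpow_neg_one, ← zpow_add₀ hp0]; norm_num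
    -- three-way split of `Σ_{s ≤ b₀} μ_s`: deficient poles / level-zero partners / controlled positions
    have hsplit : (p : ℚ) * coeffU c = ∑ s ∈ qSet c p, muTop c p s
        + (∑ s ∈ ((range ((c 0).toNat + 1)).filter fun s => ¬ inQ c p s = true).filter (fun s => lzd c p s = true),
              muTop c p s
          + ∑ s ∈ ((range ((c 0).toNat + 1)).filter fun s => ¬ inQ c p s = true).filter (fun s => ¬ lzd c p s = true),
              muTop c p s) := by
      rw [← sum_muTop_eq c hc, Finset.sum_filter_add_sum_filter_not,
        ← Finset.sum_filter_add_sum_filter_not (range ((c 0).toNat + 1)) (fun s => inQ c p s = true)]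
      rfl
    have hctl : padicNorm p (∑ s ∈ ((range ((c 0).toNat + 1)).filter fun s => ¬ inQ c p s = true).filter
        (fun s => ¬ lzd c p s = true), muTop c p s) ≤ (p : ℚ) ^ (-2 : ℤ) := by
      refine padicNorm.sum_le' (fun s hs => ?_) (zpow_p_nonneg _)
      obtain ⟨hs1, hnl⟩ := mem_filter.1 hs
      obtain ⟨hsR, hnq⟩ := mem_filter.1 hs1
      have hs' : s ≤ (c 0).toNat := by have := mem_range.1 hsR; omega
      by_cases hord : -4 ≤ netExp c s
      · rw [muTop_eq_zero_of_order_le c hc hs' hord, padicNorm.zero]; exact zpow_p_nonneg _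
      · have hndef : defClass c p (s % p) = false :=
          Bool.eq_false_iff.2 fun hdef => hnq ((inQ_iff c p s).2 ⟨by omega, hdef⟩)
        rcases hC (s % p) (mem_range.2 (Nat.mod_lt _ hp.out.pos)) s (mem_classSet_mod c hs') (by omega) hndef with
          ⟨hps, hcnt, hzr⟩ | hE | hl
        · exact padicNorm_muTop_le_of_zero c hc hp5 hwin hs' (by omega) (by rw [classPoleCount_mod]; exact hcnt) hps hzr
        · rw [← classExp_eq_of_mem (mem_classSet_mod c hs')] at hE
          exact padicNorm_muTop_le_of_exp c hc hp5 hwin hs' hE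
        · exact absurd hl hnl
    have hpart : ∑ s ∈ ((range ((c 0).toNat + 1)).filter fun s => ¬ inQ c p s = true).filter (fun s => lzd c p s = true),
          muTop c p s = 0 ∨
        ∑ s ∈ ((range ((c 0).toNat + 1)).filter fun s => ¬ inQ c p s = true).filter (fun s => lzd c p s = true),
          muTop c p s = ∑ s ∈ qSet c p, muTop c p s := by
      rcases hM with hM1 | hM2
      · left
        refine Finset.sum_eq_zero fun s hs => ?_
        obtain ⟨hs1, hl⟩ := mem_filter.1 hs
        obtain ⟨hsR, -⟩ := mem_filter.1 hs1
        have hs' : s ≤ (c 0).toNat := by have := mem_range.1 hsR; omega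
        rw [hM1 (s % p) (mem_range.2 (Nat.mod_lt _ hp.out.pos)) s (mem_classSet_mod c hs')] at hl
        exact absurd hl Bool.false_ne_true
      · right
        refine Finset.sum_nbij' (fun s => (c 0).toNat - s) (fun q => (c 0).toNat - q) ?_ ?_ ?_ ?_ ?_
        · intro s hs
          obtain ⟨hs1, hl⟩ := mem_filter.1 hs
          obtain ⟨-, -, -, hq⟩ := (lzd_iff c p s).1 hl
          exact mem_filter.2 ⟨mem_range.2 (by omega), hq⟩
        · intro q hq
          obtain ⟨hqR, hqQ⟩ := mem_filter.1 hq
          have hq' : q ≤ (c 0).toNat := by have := mem_range.1 hqR; omega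
          obtain ⟨-, hl⟩ := hM2 (q % p) (mem_range.2 (Nat.mod_lt _ hp.out.pos)) q (mem_classSet_mod c hq') hqQ
          obtain ⟨hlt, -, -, -⟩ := (lzd_iff c p ((c 0).toNat - q)).1 hl
          refine mem_filter.2 ⟨mem_filter.2 ⟨mem_range.2 (by omega), fun hin => ?_⟩, hl⟩
          obtain ⟨-, -, -, hps, -⟩ := qSet_specZ c hD (mem_filter.2 ⟨mem_range.2 (by omega), hin⟩)
          omega
        · intro s hs
          obtain ⟨hs1, -⟩ := mem_filter.1 hs
          obtain ⟨hsR, -⟩ := mem_filter.1 hs1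
          have := mem_range.1 hsR
          show (c 0).toNat - ((c 0).toNat - s) = s
          omega
        · intro q hq
          obtain ⟨hqR, -⟩ := mem_filter.1 hq
          have := mem_range.1 hqR
          show (c 0).toNat - ((c 0).toNat - q) = q
          omega
        · intro s hs
          obtain ⟨hs1, hl⟩ := mem_filter.1 hs
          obtain ⟨hsR, -⟩ := mem_filter.1 hs1
          obtain ⟨-, h5, h5', -⟩ := (lzd_iff c p s).1 hl
          exact muTop_mirror c hc (by have := mem_range.1 hsR; omega) h5 h5'
    have hkey : ∃ m : ℕ, (m = 1 ∨ m = 2) ∧ (m : ℚ) * ∑ s ∈ qSet c p, muTop c p s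
        = (p : ℚ) * coeffU c - ∑ s ∈ ((range ((c 0).toNat + 1)).filter fun s => ¬ inQ c p s = true).filter
            (fun s => ¬ lzd c p s = true), muTop c p s := by
      rcases hpart with h0 | h1
      · exact ⟨1, Or.inl rfl, by rw [hsplit, h0]; push_cast; ring⟩
      · exact ⟨2, Or.inr rfl, by rw [hsplit, h1]; push_cast; ring⟩
    obtain ⟨m, hm, hmeq⟩ := hkey
    have hmnorm : padicNorm p (m : ℚ) = 1 := by
      have hnd : ¬ p ∣ m := by
        rcases hm with rfl | rfl
        · intro hdvd; have := Nat.le_of_dvd (by norm_num) hdvd; omega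
        · intro hdvd; have := Nat.le_of_dvd (by norm_num) hdvd; omega
      exact_mod_cast (padicNorm.nat_eq_one_iff (p := p) m).2 hnd
    calc padicNorm p (∑ s ∈ qSet c p, muTop c p s) = padicNorm p ((m : ℚ) * ∑ s ∈ qSet c p, muTop c p s) := by
          rw [padicNorm.mul, hmnorm, one_mul]
      _ ≤ (p : ℚ) ^ (-2 : ℤ) := by rw [hmeq]; exact (padicNorm.sub (p := p)).trans (max_le hU hctl)
  -- (6) assemble
  have hQsum : padicNorm p (∑ s ∈ qSet c p, posV c s) ≤ (p : ℚ) ^ 4 := by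
    have hdecomp : ∑ s ∈ qSet c p, posV c s = ∑ s ∈ qSet c p, (posV c s - muTop c p s / (p : ℚ) ^ 6)
        + (∑ s ∈ qSet c p, muTop c p s) / (p : ℚ) ^ 6 := by
      rw [Finset.sum_div, ← Finset.sum_add_distrib]
      exact Finset.sum_congr rfl fun s _ => by ring
    rw [hdecomp]
    refine (padicNorm.nonarchimedean (p := p)).trans (max_le (padicNorm.sum_le' hFG (by positivity)) ?_)
    rw [padicNorm.div, CellA.padicNorm_p_pow, div_inv_eq_mul]
    calc padicNorm p (∑ s ∈ qSet c p, muTop c p s) * (p : ℚ) ^ 6 ≤ (p : ℚ) ^ (-2 : ℤ) * (p : ℚ) ^ 6 :=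
          mul_le_mul_of_nonneg_right hμ (by positivity)
      _ = (p : ℚ) ^ 4 := by
          rw [← zpow_natCast (p : ℚ) 6, ← zpow_add₀ hp0, ← zpow_natCast (p : ℚ) 4]; norm_num
  have hmain : padicNorm p (coeffV c) ≤ (p : ℚ) ^ 4 := by
    rw [hsplitV, hA]
    exact (padicNorm.nonarchimedean (p := p)).trans (max_le hQsum hB)
  have hmain' : padicNorm p (coeffV c) ≤ (p : ℚ) ^ (-(-4 : ℤ)) := by
    rw [neg_neg]; exact_mod_cast hmain
  exact ht.trans (val_ge_of_padicNorm_le hV hmain')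

/-- Kernel instances: the three archetypes left residual by the counting, palindromic and U-layer tests are ZERO-LAYER
configurations (PROVED instances of (V⁺) at `t = −4`).  `c = (12;5,5,4,4,4,4,1)`, `p = 5`: zero at `0` next to the sextic pole
`5` (zero partner), deficient poles `6, 7`.  `c = (14;7,4,4,4,4,4,1)`, `p = 7 = b₀/2`: the deficient quintic poles `8,…,13` have
the level-zero partners `1,…,6`.  `c = (16;6,6,6,6,6,6,1)`, `p = 5`: the deficient sextic pole `10` sits at level two above the
zero `0`. -/
example :
    let c : ℕ → ℤ := fun k => (([12, 5, 5, 4, 4, 4, 4, 1] : List ℤ)).getD k 0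
    uLayerCase c 5 (-4) = false ∧ zLayerCase c 5 (-4) = true := by
  decide

example :
    let c : ℕ → ℤ := fun k => (([14, 7, 4, 4, 4, 4, 4, 1] : List ℤ)).getD k 0
    uLayerCase c 7 (-4) = false ∧ zLayerCase c 7 (-4) = true := by
  decide

example :
    let c : ℕ → ℤ := fun k => (([16, 6, 6, 6, 6, 6, 6, 1] : List ℤ)).getD k 0
    uLayerCase c 5 (-4) = false ∧ zLayerCase c 5 (-4) = true := by
  decide

end ZLayer

end Summit.KontsevichZagierPeriods.Zeta5Search.ClusterValuation
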